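import Literature.NumberTheory.Automorphic.UnitaryGroupHeisenbergFundamentalDomain
import Literature.NumberTheory.Automorphic.UnitaryGroupBorelTruncation
import Literature.NumberTheory.Automorphic.UnitaryGroupUnipotentRadicalCentre
import HarnessLib

/-!
# On `U(3)` the tree's centre-only cusp condition implies the Borel cusp condition

Topic `NumberTheory/Automorphic`; namespace `Literature.NumberTheory.Automorphic.UnitaryGroup`.
THEOREMS (plus the plumbing definition `centreElt`); no named fact, no `sorry`, no instance, no
notation. Setting: Rogawski's quasi-split `U(3) = U(J₃)` over a quadratic `E/F` with involution `c`
(`c * c = 1`); `N(𝔸_F) = adelicUnipotent F E c 3` the Heisenberg group, `Z(𝔸_F) = unipotentRadical F E c 3 1`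
its centre (the erratum `UnitaryGroupUnipotentRadicalCentre`: the accepted `unipotentRadical 3 1` is
`{u(0, z)}`, NOT the unipotent radical of the Borel subgroup).

**Theorem** (`borelCuspCondition_of_cuspCondition`). Let `φ : U(3)(𝔸_F) → ℂ` be continuous and left
invariant under `U(3)(F)`. If `φ` satisfies the accepted `CuspCondition φ 1` (vanishing of
`∫_{Z(F)\Z(𝔸)} φ(z g) dz` for all `g`), then it satisfies `BorelCuspCondition φ`
(`UnitaryGroupBorelTruncation`: vanishing of `∫_{N(F)\N(𝔸)} φ(n g) dn` for all `g`, integrability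
included) — i.e. the tree's «cusp forms» ARE Borel-cuspidal (the converse fails: generic cusp forms).
Both hypotheses are needed: without continuity/invariance `φ = a(x) b(z)` with `∫ b = 0` and `a`
non-integrable satisfies the first condition and not the second.

Proof. In the Heisenberg chart `N(𝔸_F) ≅ 𝔸_E × 𝔸_E⁻` (`heisChart`) a left Haar measure is
`dx dy` (`heisHaar`), every Haar measure `ν'` of `N(𝔸_F)` is a multiple of it (Haar uniqueness), and the
integral over an arbitrary fundamental domain `𝓕'` of `N(F)` equals the integral over
`𝓕_N = heisChart(D_E × 𝓕⁻)` (`UnitaryGroupHeisenbergFundamentalDomain`, Mathlib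
`IsFundamentalDomain.setIntegral_eq` / `integrableOn_iff` — `u ↦ φ(u g)` is `N(F)`-invariant); on
`𝓕_N`, which is relatively compact, `φ(· g)` is integrable, and by Fubini
`∫_{𝓕_N} φ(u g) = ∫_{x ∈ D_E} ∫_{y ∈ 𝓕⁻} φ(u(0, y) · u(x, 0) g) dy dx`, whose inner integral is the
centre constant term of `φ` at `u(x,0) g` over the fundamental domain `u(0, 𝓕⁻)` of `Z(F)` in `Z(𝔸)`
for the transported Haar measure — zero by `CuspCondition φ 1`. Rogawski (1990), §2.1 (cusp forms:
`φ_P = 0` for all `P`; for `U(3)`, `P = B`).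

## References

* J. D. Rogawski, *Automorphic Representations of Unitary Groups in Three Variables* (1990), §1.10,
  §2.1 [Rogawski1990].
* A. Borel, H. Jacquet, *Automorphic forms and automorphic representations* (1979), 4.4
  [BorelJacquet1979].
-/

noncomputable section

open Matrix NumberField IsDedekindDomain Topology MeasureTheory Measure
open scoped MatrixGroups Pointwise NNReal ENNReal

namespace Literature.NumberTheory.Automorphic

namespace UnitaryGroup

variable {F E : Type} [Field F] [NumberField F] [Field E] [NumberField E] [Algebra F E]
  {c : E ≃ₐ[F] E}

/-! ## §1 The centre in the chart: `y ↦ u(0, y)` -/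

/-- The block-nilpotent matrix with single entry `y` at `(0, 2)`. [folklore] -/
private def cornerBlock (y : AdeleRing (𝓞 E) E) : blockNilpotent 3 1 (AdeleRing (𝓞 E) E) :=
  ⟨Matrix.of fun i j => if i = 0 ∧ j = 2 then y else 0, by
    intro i j hij
    simp only [Matrix.of_apply] at hij
    split_ifs at hij with h
    · obtain ⟨rfl, rfl⟩ := h; decide
    · exact absurd rfl hij⟩

/-- `u(0, y) ∈ Z(𝔸_F) = unipotentRadical F E c 3 1` for `y ∈ 𝔸_E⁻` (`heisZ 0 y = y`). [cite: Rogawski1990, §1.10] -/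
theorem heisChart_zero_mem_unipotentRadical (hc : c * c = 1) (y : traceZeroAdele F E c) :
    ((heisChart hc (0, y) : adelicUnipotent F E c 3) : (quasiSplit F E c 3).Adelic) ∈ unipotentRadical F E c 3 1 := by
  refine ⟨Multiplicative.ofAdd (cornerBlock (y : AdeleRing (𝓞 E) E)), Matrix.GeneralLinearGroup.ext fun i j => ?_⟩
  rw [coe_unipotentOfBlock, toAdd_ofAdd, Matrix.add_apply]
  change (1 : Matrix (Fin 3) (Fin 3) (AdeleRing (𝓞 E) E)) i j + (if i = 0 ∧ j = 2 then (y : AdeleRing (𝓞 E) E) else 0) =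
    heisMatrix (c := c) 0 (y : AdeleRing (𝓞 E) E) i j
  fin_cases i <;> fin_cases j <;> simp [heisMatrix, heisZ]

/-- **The centre in the chart**: `centreElt hc y = u(0, y) ∈ Z(𝔸_F)`. [cite: Rogawski1990, §1.10] -/
def centreElt (hc : c * c = 1) (y : traceZeroAdele F E c) : unipotentRadical F E c 3 1 :=
  ⟨((heisChart hc (0, y) : adelicUnipotent F E c 3) : (quasiSplit F E c 3).Adelic), heisChart_zero_mem_unipotentRadical hc y⟩

/-- `centreElt` on adelic points. [cite: Rogawski1990, §1.10] -/
@[simp] theorem coe_centreElt (hc : c * c = 1) (y : traceZeroAdele F E c) :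
    ((centreElt hc y : unipotentRadical F E c 3 1) : (quasiSplit F E c 3).Adelic) =
      ((heisChart hc (0, y) : adelicUnipotent F E c 3) : (quasiSplit F E c 3).Adelic) := rfl

/-- **`u(0, y) · u(x, y') = u(x, y + y')`**: the centre acts by translating the `y`-coordinate.
[cite: Rogawski1990, §1.10] -/
theorem heisChart_zero_mul (hc : c * c = 1) (y : traceZeroAdele F E c) (x : AdeleRing (𝓞 E) E)
    (y' : traceZeroAdele F E c) : heisChart hc (0, y) * heisChart hc (x, y') = heisChart hc (x, y + y') := by
  apply (heisChart hc).symm.injective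
  rw [Homeomorph.symm_apply_apply, heisChart_symm_apply]
  refine Prod.ext ?_ (Subtype.ext ?_)
  · rw [coordX_mul_heisChart, coordX_heisChart, zero_add]
  · rw [coe_coordY_mul_heisChart, coordY_heisChart, coordX_heisChart]
    simp only [map_zero, mul_zero, zero_mul, sub_self, add_zero, AddSubgroup.coe_add]
    ring

/-- `centreElt` is additive-to-multiplicative: `u(0, y + y') = u(0, y) u(0, y')`. [cite: Rogawski1990, §1.10] -/
theorem centreElt_add (hc : c * c = 1) (y y' : traceZeroAdele F E c) :
    centreElt hc (y + y') = centreElt hc y * centreElt hc y' := by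
  refine Subtype.ext ?_
  change ((heisChart hc (0, y + y') : adelicUnipotent F E c 3) : (quasiSplit F E c 3).Adelic) =
    ((heisChart hc (0, y) : adelicUnipotent F E c 3) : (quasiSplit F E c 3).Adelic) *
      ((heisChart hc (0, y') : adelicUnipotent F E c 3) : (quasiSplit F E c 3).Adelic)
  rw [← Subgroup.coe_mul, heisChart_zero_mul]

/-- Every element of `Z(𝔸_F)` is `u(0, y)`: its `x`-coordinate vanishes
(`apply_superdiag_eq_zero_of_mem_unipotentRadical_three`). [cite: Rogawski1990, §1.10] -/
theorem exists_centreElt_eq (hc : c * c = 1) (z : unipotentRadical F E c 3 1) : ∃ y, centreElt hc y = z := by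
  set u : adelicUnipotent F E c 3 := ⟨(z : (quasiSplit F E c 3).Adelic), unipotentRadical_le_adelicUnipotent 1 z.2⟩ with hu
  have hx : coordX u = 0 := (apply_superdiag_eq_zero_of_mem_unipotentRadical_three z.2).1
  refine ⟨coordY hc u, Subtype.ext ?_⟩
  change ((heisChart hc (0, coordY hc u) : adelicUnipotent F E c 3) : (quasiSplit F E c 3).Adelic) = (u : _)
  rw [← hx, heisChart_coord]

/-- `centreElt` is injective. [cite: Rogawski1990, §1.10] -/
theorem centreElt_injective (hc : c * c = 1) : Function.Injective (centreElt (F := F) (E := E) hc) := by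
  intro y y' h
  have h' : heisChart hc (0, y) = heisChart hc (0, y') :=
    Subtype.ext (congrArg (fun z : unipotentRadical F E c 3 1 => (z : (quasiSplit F E c 3).Adelic)) h)
  have := congrArg (coordY hc) h'
  rwa [coordY_heisChart, coordY_heisChart] at this

/-- The inverse of `centreElt`: the `y`-coordinate. [cite: Rogawski1990, §1.10] -/
def centreCoord (hc : c * c = 1) (z : unipotentRadical F E c 3 1) : traceZeroAdele F E c :=
  coordY hc ⟨(z : (quasiSplit F E c 3).Adelic), unipotentRadical_le_adelicUnipotent 1 z.2⟩

/-- `centreCoord (centreElt y) = y`. [cite: Rogawski1990, §1.10] -/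
@[simp] theorem centreCoord_centreElt (hc : c * c = 1) (y : traceZeroAdele F E c) :
    centreCoord hc (centreElt hc y) = y := coordY_heisChart hc (0, y)

/-- `centreElt (centreCoord z) = z`. [cite: Rogawski1990, §1.10] -/
@[simp] theorem centreElt_centreCoord (hc : c * c = 1) (z : unipotentRadical F E c 3 1) :
    centreElt hc (centreCoord hc z) = z := by
  obtain ⟨y, rfl⟩ := exists_centreElt_eq hc z
  rw [centreCoord_centreElt]

/-- **`Z(𝔸_F) ≃ₜ 𝔸_E⁻`**, `y ↦ u(0, y)`. [cite: Rogawski1990, §1.10] -/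
def centreHomeomorph (hc : c * c = 1) : traceZeroAdele F E c ≃ₜ unipotentRadical F E c 3 1 where
  toFun := centreElt hc
  invFun := centreCoord hc
  left_inv := centreCoord_centreElt hc
  right_inv := centreElt_centreCoord hc
  continuous_toFun := (continuous_subtype_val.comp ((heisChart hc).continuous.comp
    (continuous_const.prodMk continuous_id))).subtype_mk _
  continuous_invFun := (continuous_heisY hc).comp (continuous_unipToBorel.comp (continuous_subtype_val.subtype_mk _))

/-- `centreHomeomorph hc y = centreElt hc y`. [cite: Rogawski1990, §1.10] -/
@[simp] theorem centreHomeomorph_apply (hc : c * c = 1) (y : traceZeroAdele F E c) :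
    centreHomeomorph hc y = centreElt hc y := rfl

/-- **Rational points of the centre**: `u(0, y) ∈ Z(F)` iff `y ∈ E⁻`. [cite: Rogawski1990, §1.10] -/
theorem centreElt_mem_rational_iff (hc : c * c = 1) (y : traceZeroAdele F E c) :
    centreElt hc y ∈ rationalUnipotentRadical F E c 3 1 ↔ y ∈ rationalTraceZero F E c := by
  haveI : Nontrivial (AdeleRing (𝓞 E) E) :=
    inferInstanceAs (Nontrivial (InfiniteAdeleRing E × FiniteAdeleRing (𝓞 E) E))
  constructor
  · intro h
    -- `u(0, y)` rational ⇒ as an element of `N(F)` its `y`-coordinate is principal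
    have hN : (heisChart hc (0, y) : adelicUnipotent F E c 3) ∈ rationalUnipotent F E c 3 := h
    have := coordY_mem_rationalTraceZero_of_mem hc hN
    rwa [coordY_heisChart] at this
  · intro h
    obtain ⟨η, hη⟩ := (mem_rationalTraceZero_iff _).1 h
    have hηc : c η = -η := by
      have h2 := (mem_traceZeroAdele_iff _).1 y.2
      rw [← hη, ← algebraMap_conj, RingHom.coe_coe, ← map_neg] at h2
      exact (algebraMap E (AdeleRing (𝓞 E) E)).injective h2
    have hy : y = ⟨algebraMap E (AdeleRing (𝓞 E) E) η, algebraMap_mem_traceZeroAdele hηc⟩ := Subtype.ext hη.symm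
    subst hy
    have hrat := (ratHeisElt hc (0 : E) hηc).2
    change (heisChart hc (algebraMap E (AdeleRing (𝓞 E) E) 0, _) : adelicUnipotent F E c 3) ∈ rationalUnipotent F E c 3 at hrat
    rw [map_zero] at hrat
    exact hrat

/-! ## §2 The theorem -/

section Main

/-- **On `U(3)`, `CuspCondition φ 1 → BorelCuspCondition φ`** for continuous, left `U(3)(F)`-invariant
`φ` (Rogawski (1990), §2.1; see the module docstring for the proof and for why both hypotheses are
needed). [cite: Rogawski1990, §2.1] -/
theorem borelCuspCondition_of_cuspCondition (hc : c * c = 1) {φ : (quasiSplit F E c 3).Adelic → ℂ} (hφc : Continuous φ)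
    (hφinv : ∀ γ ∈ (quasiSplit F E c 3).arithmeticSubgroup, ∀ g : (quasiSplit F E c 3).Adelic, φ (γ * g) = φ g)
    (hcusp : CuspCondition F E c 3 φ 1) : BorelCuspCondition F E c 3 φ := by
  intro mN bN ν hν 𝓕' h𝓕' g
  -- topology / measure instances
  haveI := secondCountableTopology_adeleRing E
  haveI := locallyCompactSpace_adeleRing' E
  haveI : T2Space (quasiSplit F E c 3).Adelic :=
    inferInstanceAs (T2Space (adelic F E c 3 ((StdForm.antidiagonal 3).over E)))
  haveI : LocallyCompactSpace (quasiSplit F E c 3).Adelic :=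
    inferInstanceAs (LocallyCompactSpace (adelic F E c 3 ((StdForm.antidiagonal 3).over E)))
  haveI : SecondCountableTopology (quasiSplit F E c 3).Adelic :=
    inferInstanceAs (SecondCountableTopology (adelic F E c 3 ((StdForm.antidiagonal 3).over E)))
  letI : MeasurableSpace (AdeleRing (𝓞 E) E) := borel _
  haveI : BorelSpace (AdeleRing (𝓞 E) E) := ⟨rfl⟩
  haveI := locallyCompactSpace_traceZeroAdele (F := F) (E := E) (c := c)
  haveI : SecondCountableTopology (traceZeroAdele F E c) := TopologicalSpace.Subtype.secondCountableTopology _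
  letI : MeasurableSpace (unipotentInBorel F E c 3) := borel _
  haveI : BorelSpace (unipotentInBorel F E c 3) := ⟨rfl⟩
  -- `N(𝔸_F) ≅ 𝔸_E × 𝔸_E⁻` is locally compact and second countable
  haveI : LocallyCompactSpace (adelicUnipotent F E c 3) := (heisChart hc).symm.isClosedEmbedding.locallyCompactSpace
  haveI : SecondCountableTopology (adelicUnipotent F E c 3) := TopologicalSpace.Subtype.secondCountableTopology _
  -- the action of `N(F)`
  haveI : Countable (rationalUnipotent F E c 3) := by
    have hinj : Function.Injective fun γ : rationalUnipotent F E c 3 =>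
        (⟨((γ : adelicUnipotent F E c 3) : (quasiSplit F E c 3).Adelic), γ.2⟩ : (quasiSplit F E c 3).arithmeticSubgroup) := by
      intro a b hab
      exact Subtype.ext (Subtype.ext (congrArg (fun z : (quasiSplit F E c 3).arithmeticSubgroup => (z : (quasiSplit F E c 3).Adelic)) hab))
    haveI : Countable (quasiSplit F E c 3).arithmeticSubgroup := by
      haveI : Countable E := NumberField.countable' (K := E)
      haveI : Countable (Matrix (Fin 3) (Fin 3) E) := inferInstanceAs (Countable (Fin 3 → Fin 3 → E))
      haveI : Countable (GL (Fin 3) E) := Units.val_injective.countable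
      haveI : Countable (quasiSplit F E c 3).Rational :=
        inferInstanceAs (Countable (rational F E c 3 ((StdForm.antidiagonal 3).over E)))
      exact (Set.countable_range _).to_subtype
    exact hinj.countable
  haveI : MeasurableConstSMul (rationalUnipotent F E c 3) (adelicUnipotent F E c 3) :=
    ⟨fun γ => (continuous_const.mul continuous_id).measurable⟩
  haveI : SMulInvariantMeasure (rationalUnipotent F E c 3) (adelicUnipotent F E c 3) ν :=
    ⟨fun γ s hs => by
      rw [show (fun x => γ • x) ⁻¹' s = (fun x => ((γ : adelicUnipotent F E c 3) * x)) ⁻¹' s from rfl,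
        measure_preimage_mul]⟩
  -- the integrand is `N(F)`-invariant and continuous
  set f : adelicUnipotent F E c 3 → ℂ := fun u => φ ((u : (quasiSplit F E c 3).Adelic) * g) with hf
  have hf_inv : ∀ (γ : rationalUnipotent F E c 3) (u : adelicUnipotent F E c 3), f (γ • u) = f u := by
    intro γ u
    simp only [hf, Subgroup.smul_def, smul_eq_mul, Subgroup.coe_mul, mul_assoc]
    exact hφinv _ γ.2 _
  have hfc : Continuous f := hφc.comp (continuous_subtype_val.mul continuous_const)
  -- the preferred fundamental domain
  have h0 := isFundamentalDomain_heisFundamentalDomain (F := F) (E := E) (c := c) hc ν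
  obtain ⟨C, hC, hsub⟩ := exists_isCompact_heisFundamentalDomain_subset (F := F) (E := E) (c := c) hc
  have hint0 : IntegrableOn f (heisFundamentalDomain F E c hc) ν :=
    (hfc.continuousOn.integrableOn_compact hC).mono_set hsub
  refine ⟨(h0.integrableOn_iff h𝓕' hf_inv).1 hint0, ?_⟩
  rw [h𝓕'.setIntegral_eq h0 hf_inv]
  -- the coordinate Haar measure `μ₀` and `ν = κ • μ₀`
  set μX : Measure (AdeleRing (𝓞 E) E) := Measure.addHaar with hμX
  set μY : Measure (traceZeroAdele F E c) := Measure.addHaar with hμY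
  haveI : μX.Regular := inferInstance
  haveI : μY.Regular := inferInstance
  haveI := isHaarMeasure_heisHaar hc μX μY
  set μ₀ : Measure (adelicUnipotent F E c 3) := (heisHaar hc μX μY).map (unipToBorelₜ F E c).symm with hμ₀
  haveI : μ₀.IsHaarMeasure := ContinuousMulEquiv.isHaarMeasure_map (heisHaar hc μX μY) (unipToBorelₜ F E c).symm
  have hμ₀' : μ₀ = (μX.prod μY).map (heisChart hc) := by
    have hm1 : Measurable (fun v : unipotentInBorel F E c 3 => (unipToBorelₜ F E c).symm v) :=
      continuous_unipToBorel_symm.measurable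
    have hm2 : Measurable (fun p : AdeleRing (𝓞 E) E × traceZeroAdele F E c => heisHomeomorph hc p) :=
      (heisHomeomorph hc).continuous.measurable
    rw [hμ₀, heisHaar]
    exact Measure.map_map hm1 hm2
  have hνκ : ν = haarScalarFactor ν μ₀ • μ₀ := isMulLeftInvariant_eq_smul_of_regular ν μ₀
  rw [hνκ, Measure.restrict_smul, integral_smul_nnreal_measure]
  suffices hzero : ∫ u in heisFundamentalDomain F E c hc, f u ∂μ₀ = 0 by rw [hzero, smul_zero]
  -- pull back along the chart and apply Fubini
  have hint0' : IntegrableOn f (heisFundamentalDomain F E c hc) μ₀ :=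
    (hfc.continuousOn.integrableOn_compact hC).mono_set hsub
  set e := (heisChart hc).toMeasurableEquiv with he
  have hμ₀e : μ₀ = (μX.prod μY).map e := hμ₀'
  have hpre : e ⁻¹' heisFundamentalDomain F E c hc = adeleFundamentalDomain E ×ˢ traceZeroFundamentalDomain F E c := by
    rw [heisFundamentalDomain, show (⇑(heisChart hc)) = ⇑e from rfl, e.preimage_image]
  rw [hμ₀e, setIntegral_map_equiv, hpre]
  have hintP : IntegrableOn (fun p => f (e p)) (adeleFundamentalDomain E ×ˢ traceZeroFundamentalDomain F E c) (μX.prod μY) := by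
    have := (integrableOn_map_equiv e (f := f) (μ := μX.prod μY) (s := heisFundamentalDomain F E c hc)).1 (hμ₀e ▸ hint0')
    rwa [hpre] at this
  rw [setIntegral_prod _ hintP]
  refine setIntegral_eq_zero_of_forall_eq_zero fun x _ => ?_
  -- the inner integral is the centre constant term at `u(x, 0) g`
  change ∫ y in traceZeroFundamentalDomain F E c, φ (((heisChart hc (x, y) : adelicUnipotent F E c 3) :
    (quasiSplit F E c 3).Adelic) * g) ∂μY = 0
  have hsplit : ∀ y : traceZeroAdele F E c, ((heisChart hc (x, y) : adelicUnipotent F E c 3) : (quasiSplit F E c 3).Adelic) * g =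
      ((centreElt hc y : unipotentRadical F E c 3 1) : (quasiSplit F E c 3).Adelic) *
        (((heisChart hc (x, 0) : adelicUnipotent F E c 3) : (quasiSplit F E c 3).Adelic) * g) := by
    intro y
    rw [← mul_assoc, coe_centreElt, ← Subgroup.coe_mul, heisChart_zero_mul, add_zero]
  rw [show (fun y : traceZeroAdele F E c => φ (((heisChart hc (x, y) : adelicUnipotent F E c 3) :
      (quasiSplit F E c 3).Adelic) * g)) = fun y => φ (((centreElt hc y : unipotentRadical F E c 3 1) :
        (quasiSplit F E c 3).Adelic) * ((((heisChart hc (x, 0) : adelicUnipotent F E c 3) :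
          (quasiSplit F E c 3).Adelic)) * g)) from funext fun y => congrArg φ (hsplit y)]
  -- transport `μY` and `𝓕⁻` to `Z(𝔸_F)` and apply the cusp condition there
  letI : MeasurableSpace (unipotentRadical F E c 3 1) := borel _
  haveI : BorelSpace (unipotentRadical F E c 3 1) := ⟨rfl⟩
  set eZ := (centreHomeomorph hc).toMeasurableEquiv with heZ
  set νZ : Measure (unipotentRadical F E c 3 1) := μY.map eZ with hνZ
  have hνZK : ∀ K : Set (unipotentRadical F E c 3 1), IsCompact K → νZ K < ⊤ := fun K hK => by
    rw [hνZ, MeasurableEquiv.map_apply]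
    exact ((centreHomeomorph hc).isCompact_preimage.2 hK).measure_lt_top
  haveI : IsFiniteMeasureOnCompacts νZ := ⟨hνZK⟩
  haveI : νZ.IsOpenPosMeasure := ⟨fun U hU hne => by
    rw [hνZ, MeasurableEquiv.map_apply]
    refine (hU.preimage (centreHomeomorph hc).continuous).measure_ne_zero μY ?_
    obtain ⟨z, hz⟩ := hne
    exact ⟨(centreHomeomorph hc).symm z, by
      change (centreHomeomorph hc) ((centreHomeomorph hc).symm z) ∈ U
      rwa [Homeomorph.apply_symm_apply]⟩⟩
  haveI : νZ.IsMulLeftInvariant := ⟨fun z₀ => by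
    obtain ⟨y₀, rfl⟩ := exists_centreElt_eq hc z₀
    have hcomm : (fun z => centreElt hc y₀ * z) ∘ eZ = eZ ∘ fun y => y₀ + y := by
      funext y
      simp only [Function.comp_apply]
      change centreElt hc y₀ * centreElt hc y = centreElt hc (y₀ + y)
      rw [centreElt_add]
    rw [hνZ, Measure.map_map (measurable_const_mul _) eZ.measurable, hcomm,
      ← Measure.map_map eZ.measurable (measurable_const_add y₀), map_add_left_eq_self]⟩
  haveI : νZ.IsHaarMeasure := {}
  have hFD : IsFundamentalDomain (rationalUnipotentRadical F E c 3 1) (eZ '' traceZeroFundamentalDomain F E c) νZ := by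
    refine IsFundamentalDomain.mk' ?_ fun z => ?_
    · exact ((eZ.measurableSet_image).2 measurableSet_traceZeroFundamentalDomain).nullMeasurableSet
    · obtain ⟨y, rfl⟩ := exists_centreElt_eq hc z
      obtain ⟨gy, hgy, hgyuniq⟩ := existsUnique_vadd_mem_traceZeroFundamentalDomain hc y
      refine ⟨⟨centreElt hc (gy : traceZeroAdele F E c), (centreElt_mem_rational_iff hc _).2 gy.2⟩, ?_, ?_⟩
      · refine ⟨(gy : traceZeroAdele F E c) + y, hgy, ?_⟩
        change centreElt hc ((gy : traceZeroAdele F E c) + y) = centreElt hc gy * centreElt hc y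
        rw [centreElt_add]
      · rintro ⟨γ, hγ⟩ ⟨y', hy', hγy⟩
        obtain ⟨y₁, rfl⟩ := exists_centreElt_eq hc γ
        have hy₁ : y₁ ∈ rationalTraceZero F E c := (centreElt_mem_rational_iff hc y₁).1 hγ
        change centreElt hc y' = centreElt hc y₁ * centreElt hc y at hγy
        rw [← centreElt_add] at hγy
        have hyy : y' = y₁ + y := centreElt_injective hc hγy
        have hmem : ((⟨y₁, hy₁⟩ : rationalTraceZero F E c) +ᵥ y) ∈ traceZeroFundamentalDomain F E c := by
          change y₁ + y ∈ traceZeroFundamentalDomain F E c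
          rw [← hyy]; exact hy'
        have := hgyuniq ⟨y₁, hy₁⟩ hmem
        exact Subtype.ext (by rw [← this])
  obtain ⟨-, hZ⟩ := hcusp νZ (eZ '' traceZeroFundamentalDomain F E c) hFD
    ((((heisChart hc (x, 0) : adelicUnipotent F E c 3) : (quasiSplit F E c 3).Adelic) * g))
  rw [hνZ, setIntegral_map_equiv, eZ.preimage_image] at hZ
  exact hZ

end Main

end UnitaryGroup

end Literature.NumberTheory.Automorphic
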